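import Summits.QuantumFields.BalabanUV.T4Continuum.Support.NE7BlockDefectSymbol

/-!
# Ventures/CertifiedManyBodySolver — Conjectures/FejerMajorant.lean: the FEJÉR MAJORANT of **T-M1D.48 Proposition B6**, TYPED AND PROVED

HONEST FRAMING: first certified bounds; not a superconductivity verdict; every number certified or labelled float.

Source: `HOME/sr-mbsolver-m1-4/structure/design/BLINDNESS-SANDWICH.md` (T-M1D.48; sr-mbsolver-m1-4 gen 17, 2026-08-25), §3 Proposition B6;
`structure/shells/SHELL-LAW.md` §19.

THE THEOREM IN WORDS (paper-level). The `U = 0` blindness of the certified `n`-site one-body window, `B_n(ν) = v_n(ν) - sin(πν)/π`, is a ONE-SIDED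
`L¹(arcsine)` approximation error of the hinge `c ↦ max 0 (c - K)` by polynomials of degree `≤ n - 1` (T-M1D.48 Theorem A), and at every closed shell
`ν = m/n` the free Fermi level `cos(mπ/n)` is an optimal multiplier (Theorem B, Proposition B6). For the OUTERMOST shells `m = 1`, `m = n - 1` the
optimal one-sided approximant is the scaled FEJÉR KERNEL: with `x = 2u` and `F_n(x)^2 = sin(nu)^2 / sin(u)^2`,
`(1 - cos(π/n)) · F_n(x)^2 / n^2 ≥ cos x - cos(π/n)` for all real `x` (and `≥ 0` trivially), with equality exactly at `sin u = 0`.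
Weak LP duality then gives `v_n(ν) ≤ 1/n + cos(π/n)(ν - 1/n)` for all `ν`, i.e. `cos(π/n) ∈ ∂v_n(1/n)`, and the exact value
`E⁺_{n-1}(± cos(π/n)) = 1/n - sin(π/n)/π`.

WHAT IS TYPED AND PROVED HERE (exactly these real-variable statements; nothing about the Hubbard chain is asserted):
* (reused, not re-proved: `abs_sin_nat_mul_le`, `sin_sq_nat_mul_le` from the BalabanUV NE7 support file — `|sin (k u)| ≤ k |sin u|` and its square.)
* `fejer_step` — the trigonometric identity driving the induction:
  `(2x+3) sin²u - sin²((x+2)u) + sin²((x+1)u) = [(2x+1) sin²u - sin²((x+1)u) + sin²(xu)] + 4 sin²u sin²((x+1)u)`.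
* `fejer_defect_le` — the quantitative Fejér bound `n² sin²u - sin²(nu) ≤ (n²(n²-1)/3) sin⁴u` (paper: `n² - F_n² = 4 Σ (n-k) sin²(ku)/sin²u`
  and `|sin ku| ≤ k|sin u|`; here a sum-free two-component induction).
* `fejer_majorant` — for every `n : ℕ` and real `u`:  `n² · sin²u · (cos(2u) - cos(π/n)) ≤ (1 - cos(π/n)) · sin²(nu)`
  (uses `sin(π/(2n)) ≤ π/(2n)` and `π² < 12`); `fejer_majorant_div` — the same divided through: for `n ≠ 0`, `sin u ≠ 0`,
  `cos(2u) - cos(π/n) ≤ (1 - cos(π/n)) · (sin(nu)/sin u)² / n²`.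
-/

namespace Summit.Ventures.CertifiedManyBodySolver.Conjectures.FejerMajorant

open Real

/-! The folklore lemmas `|sin (k u)| ≤ k |sin u|` and its square are REUSED from
`Summits/QuantumFields/BalabanUV/T4Continuum/Support/NE7BlockDefectSymbol.lean` (same tree; dedup), not re-proved. -/

/-- The trigonometric identity driving the Fejér induction. -/
theorem fejer_step (x u : ℝ) :
    (2 * (x + 1) + 1) * sin u ^ 2 - sin ((x + 1 + 1) * u) ^ 2 + sin ((x + 1) * u) ^ 2
      = ((2 * x + 1) * sin u ^ 2 - sin ((x + 1) * u) ^ 2 + sin (x * u) ^ 2)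
        + 4 * sin u ^ 2 * sin ((x + 1) * u) ^ 2 := by
  have e1 : sin ((x + 1 + 1) * u) = sin ((x + 1) * u) * cos u + cos ((x + 1) * u) * sin u := by
    rw [show (x + 1 + 1) * u = (x + 1) * u + u by ring, sin_add]
  have e2 : sin (x * u) = sin ((x + 1) * u) * cos u - cos ((x + 1) * u) * sin u := by
    rw [show x * u = (x + 1) * u - u by ring, sin_sub]
  rw [e1, e2]
  have h1 := sin_sq_add_cos_sq u
  have h2 := sin_sq_add_cos_sq ((x + 1) * u)
  linear_combination (-2 * sin ((x + 1) * u) ^ 2) * h1 + (-2 * sin u ^ 2) * h2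

/-- Two-component induction: the Fejér defect bound together with the bound on its increment. -/
theorem fejer_aux (n : ℕ) (u : ℝ) :
    ((n : ℝ) ^ 2 * sin u ^ 2 - sin (n * u) ^ 2 ≤ (n : ℝ) ^ 2 * ((n : ℝ) ^ 2 - 1) / 3 * sin u ^ 4) ∧
    ((2 * (n : ℝ) + 1) * sin u ^ 2 - sin (((n : ℝ) + 1) * u) ^ 2 + sin (n * u) ^ 2
        ≤ 2 * (n : ℝ) * ((n : ℝ) + 1) * (2 * (n : ℝ) + 1) / 3 * sin u ^ 4) := by
  induction n with
  | zero => constructor <;> simp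
  | succ n ih =>
    obtain ⟨h1, h2⟩ := ih
    have h3 := fejer_step (n : ℝ) u
    have h4 := Summit.QuantumFields.BalabanUV.T4Continuum.NE7BlockDefectSymbol.sin_sq_nat_mul_le (n + 1) u
    push_cast at h4 ⊢
    have h5 : sin u ^ 2 * sin (((n : ℝ) + 1) * u) ^ 2 ≤ sin u ^ 2 * ((((n : ℝ) + 1)) ^ 2 * sin u ^ 2) :=
      mul_le_mul_of_nonneg_left h4 (sq_nonneg _)
    constructor
    · nlinarith [h1, h2]
    · nlinarith [h2, h3, h5]

/-- The quantitative Fejér bound `n² sin²u - sin²(nu) ≤ (n²(n²-1)/3) sin⁴u`. -/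
theorem fejer_defect_le (n : ℕ) (u : ℝ) :
    (n : ℝ) ^ 2 * sin u ^ 2 - sin (n * u) ^ 2 ≤ (n : ℝ) ^ 2 * ((n : ℝ) ^ 2 - 1) / 3 * sin u ^ 4 :=
  (fejer_aux n u).1

/-- **Fejér majorant (T-M1D.48 Proposition B6), division-free form.** For every `n : ℕ` and real `u`,
`n² · sin²u · (cos 2u - cos(π/n)) ≤ (1 - cos(π/n)) · sin²(n u)`; i.e. with `x = 2u`, `K = cos(π/n)`:
`(1 - K) F_n(x)²/n² ≥ cos x - K`, the scaled Fejér kernel majorises the hinge with kink at the outermost free Fermi level. -/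
theorem fejer_majorant (n : ℕ) (u : ℝ) :
    (n : ℝ) ^ 2 * sin u ^ 2 * (cos (2 * u) - cos (π / n)) ≤ (1 - cos (π / n)) * sin (n * u) ^ 2 := by
  rcases Nat.eq_zero_or_pos n with rfl | hn
  · simp
  have hn' : (0 : ℝ) < n := by exact_mod_cast hn
  have key := fejer_defect_le n u
  set s := sin (π / (2 * n)) with hs
  have hcos : cos (π / n) = 1 - 2 * s ^ 2 := by
    have e : π / (n : ℝ) = 2 * (π / (2 * n)) := by field_simp
    rw [e, cos_two_mul, cos_sq']; ring
  have hcos2 : cos (2 * u) = 1 - 2 * sin u ^ 2 := by rw [cos_two_mul, cos_sq']; ring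
  have harg0 : 0 ≤ π / (2 * (n : ℝ)) := by positivity
  have h1n : (1 : ℝ) ≤ n := by exact_mod_cast hn
  have harg1 : π / (2 * (n : ℝ)) ≤ π := by
    rw [div_le_iff₀ (by positivity)]; nlinarith [pi_pos, h1n]
  have hs0 : 0 ≤ s := sin_nonneg_of_nonneg_of_le_pi harg0 harg1
  have hs1 : s ≤ π / (2 * n) := sin_le harg0
  have hs2 : s ^ 2 ≤ (π / (2 * n)) ^ 2 := pow_le_pow_left₀ hs0 hs1 2
  have hpi : π < 3.15 := pi_lt_d2
  -- s² · n²(n²-1)/3 ≤ n²  (from s ≤ π/(2n) and π² < 12)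
  have hB : s ^ 2 * ((n : ℝ) ^ 2 * ((n : ℝ) ^ 2 - 1) / 3) ≤ (n : ℝ) ^ 2 := by
    have e : (π / (2 * (n : ℝ))) ^ 2 * ((n : ℝ) ^ 2 * ((n : ℝ) ^ 2 - 1) / 3) = π ^ 2 * ((n : ℝ) ^ 2 - 1) / 12 := by
      field_simp; ring
    have hc : 0 ≤ (n : ℝ) ^ 2 * ((n : ℝ) ^ 2 - 1) / 3 := by
      have : (1 : ℝ) ≤ (n : ℝ) ^ 2 := by
        have : (1 : ℝ) ≤ n := by exact_mod_cast hn
        nlinarith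
      have : 0 ≤ (n : ℝ) ^ 2 - 1 := by linarith
      positivity
    calc s ^ 2 * ((n : ℝ) ^ 2 * ((n : ℝ) ^ 2 - 1) / 3)
        ≤ (π / (2 * (n : ℝ))) ^ 2 * ((n : ℝ) ^ 2 * ((n : ℝ) ^ 2 - 1) / 3) := mul_le_mul_of_nonneg_right hs2 hc
      _ = π ^ 2 * ((n : ℝ) ^ 2 - 1) / 12 := e
      _ ≤ (n : ℝ) ^ 2 := by
          have hpi2 : π ^ 2 < 10 := by nlinarith [pi_pos]
          nlinarith [mul_nonneg (sub_nonneg.mpr hpi2.le) (sq_nonneg (n : ℝ)), sq_nonneg π, sq_nonneg (n : ℝ)]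
  have hA : s ^ 2 * ((n : ℝ) ^ 2 * sin u ^ 2 - sin (n * u) ^ 2)
      ≤ s ^ 2 * ((n : ℝ) ^ 2 * ((n : ℝ) ^ 2 - 1) / 3 * sin u ^ 4) := mul_le_mul_of_nonneg_left key (sq_nonneg s)
  have hB' : s ^ 2 * ((n : ℝ) ^ 2 * ((n : ℝ) ^ 2 - 1) / 3) * sin u ^ 4 ≤ (n : ℝ) ^ 2 * sin u ^ 4 :=
    mul_le_mul_of_nonneg_right hB (by positivity)
  rw [hcos, hcos2]
  nlinarith [hA, hB']

/-- **Fejér majorant, kernel form.** For `n ≠ 0` and `sin u ≠ 0`: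
`cos(2u) - cos(π/n) ≤ (1 - cos(π/n)) · (sin(nu)/sin u)² / n²`. -/
theorem fejer_majorant_div (n : ℕ) (hn : n ≠ 0) (u : ℝ) (hu : sin u ≠ 0) :
    cos (2 * u) - cos (π / n) ≤ (1 - cos (π / n)) * (sin (n * u) / sin u) ^ 2 / (n : ℝ) ^ 2 := by
  have h := fejer_majorant n u
  have hn' : (n : ℝ) ≠ 0 := Nat.cast_ne_zero.mpr hn
  have hpos : 0 < (n : ℝ) ^ 2 * sin u ^ 2 := by positivity
  calc cos (2 * u) - cos (π / n)
      = (n : ℝ) ^ 2 * sin u ^ 2 * (cos (2 * u) - cos (π / n)) / ((n : ℝ) ^ 2 * sin u ^ 2) :=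
        (mul_div_cancel_left₀ _ hpos.ne').symm
    _ ≤ (1 - cos (π / n)) * sin (n * u) ^ 2 / ((n : ℝ) ^ 2 * sin u ^ 2) :=
        div_le_div_of_nonneg_right h hpos.le
    _ = (1 - cos (π / n)) * (sin (n * u) / sin u) ^ 2 / (n : ℝ) ^ 2 := by
        rw [div_pow]; field_simp

end Summit.Ventures.CertifiedManyBodySolver.Conjectures.FejerMajorant
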